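import Summits.KontsevichZagierPeriods.Zeta5Search.Barrier.ConeGammaCuspRays

/-!
# ζ(5) search — BARRIER: THE RAY CRITERION — a cusp top is decided at the rays of the rate arrangement

HONEST FRAMING (cell `pub-zeta5`): systematic search; no irrationality claim unless kernel-certified. MODEL objects
under Brown–Zudilin's (28)+(30) accounting ([BZ22] = arXiv:2210.03391; (28) observed, not proved); nothing here is a
statement about `ζ(5)`, any `γ` of record, the cone's supremum (C2 OPEN) or the value / sign of the cusp slope at a
named direction (DATA of the cell); no ray at a named direction and no value of `σ` there enters the kernel; S-E
stays CONJECTURED; records in print UNMOVED. Prover P2 g35, item «THE RAY CRITERION AND THE ORDER-TYPE FORM», file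
(2) (theorems only).

THE POINT. P2 g34 settled the H-side: «`σ ≤ 0` in every direction» ⇔ every generic chamber carries a Farkas
certificate on its wall gaps. This file is the V-side, with NO generators supplied as data: the cusp slope `σ =
cuspSlope a T` is the linear chamber functional `G_{δ₀}` on each closed chamber (P2 g31), the chamber weights sum to
zero, and file (1) (`exists_ray_pos_of_pos`, Schrijver §8.5 basic optimum solutions IN THE TREE) puts a positive value of
a chamber functional at a RAY of the chamber — a displacement with two distinct rates whose tie pattern is RIGID (every
tie-preserving displacement lies in `span{x, s(a)}`). Hence, for ANY period pattern function (any extension, and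
canonically with P2 g33's `F = Σ_b patternN_b`):
* **`exists_ascent_ray_of_cuspSlope_pos`** — an ascent direction in the closed chamber of a generic reference forces an
  ASCENT RAY of that chamber (normalised to rates in `[0,1]`): the steepest normalised ascent of a chamber sits at a ray;
* **`cuspSlope_nonpos_on_chamber_iff_rays`** — `σ ≤ 0` on a closed chamber ⇔ `σ ≤ 0` at the rays it contains;
* **`forall_cuspSlope_nonpos_iff_forall_ray`** — A CUSP TOP, EXACTLY, V-SIDE: `σ ≤ 0` in every direction ⇔ `σ ≤ 0` at
  every (normalised) RAY of the rate arrangement — a test set that depends on the direction `a` alone (not on `T` or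
  `F`), finite modulo the gauge `x ↦ u•x + t•s(a)` (file (3)); `exists_ascent_iff_exists_ascent_ray`;
* **`farkas_certificate_iff_rays_nonpos`** — per chamber the three are one: Farkas certificate (P2 g34) ⇔ no ascent
  direction in the chamber ⇔ `σ ≤ 0` at the chamber's rays;
* canonical forms with hpos / hT / hper / hF only.
What stays DATA: which rays ascend at a named direction (at record/41, flag/60, argmax-120, t*/480 ascent directions —
hence ascent rays — exist: `HOME/pub-zeta5-p2/g35/alg/`); no count of rays is asserted; nothing about `γ`, C2, S-E or
`ζ(5)`.
-/

noncomputable section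

open Set MeasureTheory Finset
open scoped Topology

namespace Summit.KontsevichZagierPeriods.Zeta5Search.Barrier.ConeGamma

/-! ### An ascent direction in a chamber forces an ascent ray of the chamber -/

/-- **AN ASCENT DIRECTION IN A CHAMBER FORCES AN ASCENT RAY OF THAT CHAMBER** (any period pattern function `F`, any
extension). All 28 forms of `a` positive, `T > 0` a period, `δ₀` a generic reference. If some `δ` in the closed chamber
of `δ₀` has `cuspSlope a T δ > 0`, then some `x` in the same closed chamber, with rates in `[0, 1]`, two of them
distinct, and a RIGID tie pattern (every tie-preserving displacement lies in `span{x, s(a)}` — a ray of the rate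
arrangement) has `cuspSlope a T x > 0`, and `x` MAXIMISES the cusp slope over the closed chamber cut to rate spread `≤ 1`:
the steepest normalised ascent of a chamber sits at a ray. (On the chamber `σ = G_{δ₀}`, `Σ_k W_k(δ₀) = 0`, and file (1).) -/
theorem exists_ascent_ray_of_cuspSlope_pos {a : Dir} (hpos : ∀ k, 0 < h28 a k) {T : ℝ} (hT : 0 < T)
    (hper : ∀ k : Fin 28, ∃ z : ℤ, T * h28 a k = z)
    {M : ℕ → Finset (Fin 28)} {f : ℕ → Finset (Fin 28) → ℝ}
    (hf : ∀ m, m + 1 < (bkpts a T).card → ∀ Δ : Fin 8 → ℝ, (∀ k, |phiForm Δ k| < 1) →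
      (∀ k, |phiForm Δ k| < wallDist a T) →
        (torusN (bkpt a T m • sParam a + Δ) : ℝ) = f m ((M m).filter fun k => 0 ≤ phiForm Δ k))
    {F : Finset (Fin 28) → ℝ} (hF : ∀ A, F A = ∑ m ∈ Finset.range ((bkpts a T).card - 1), f m (A ∩ M m))
    {δ₀ : Fin 8 → ℝ} (hgen : ∀ k l : Fin 28, k ≠ l → phiForm δ₀ k / h28 a k ≠ phiForm δ₀ l / h28 a l)
    {δ : Fin 8 → ℝ} (href : ∀ k l : Fin 28, phiForm δ k / h28 a k < phiForm δ l / h28 a l →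
      phiForm δ₀ k / h28 a k < phiForm δ₀ l / h28 a l) (hσ : 0 < cuspSlope a T δ) :
    ∃ x : Fin 8 → ℝ, (∀ k l : Fin 28, phiForm x k / h28 a k < phiForm x l / h28 a l →
        phiForm δ₀ k / h28 a k < phiForm δ₀ l / h28 a l) ∧
      (∀ k, 0 ≤ phiForm x k / h28 a k ∧ phiForm x k / h28 a k ≤ 1) ∧
      ((∃ k l, phiForm x k / h28 a k ≠ phiForm x l / h28 a l) ∧
        ∀ d : Fin 8 → ℝ, (∀ k l, phiForm x k / h28 a k = phiForm x l / h28 a l →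
          phiForm d k / h28 a k = phiForm d l / h28 a l) → ∃ u t : ℝ, d = u • x + t • sParam a) ∧
      (∀ δ' : Fin 8 → ℝ, (∀ k l : Fin 28, phiForm δ' k / h28 a k < phiForm δ' l / h28 a l →
          phiForm δ₀ k / h28 a k < phiForm δ₀ l / h28 a l) →
        (∀ k l, phiForm δ' k / h28 a k - phiForm δ' l / h28 a l ≤ 1) → cuspSlope a T δ' ≤ cuspSlope a T x) ∧
      0 < cuspSlope a T x := by
  rw [cuspSlope_eq_greedy_period_of_refines hpos hT hper hf hF hgen δ href] at hσ
  obtain ⟨x, hxref, hx01, hray, hmax, hval⟩ :=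
    exists_ray_pos_of_pos hpos hgen (period_greedy_sum_eq_zero hpos hT hper hf hF hgen) href hσ
  refine ⟨x, hxref, hx01, hray, fun δ' hδ' h1 => ?_, ?_⟩
  · rw [cuspSlope_eq_greedy_period_of_refines hpos hT hper hf hF hgen x hxref,
      cuspSlope_eq_greedy_period_of_refines hpos hT hper hf hF hgen δ' hδ']
    exact hmax δ' hδ' h1
  · rwa [cuspSlope_eq_greedy_period_of_refines hpos hT hper hf hF hgen x hxref]

/-- **`σ ≤ 0` ON A CLOSED CHAMBER ⇔ `σ ≤ 0` AT ITS RAYS** (any `F`, any extension; `δ₀` generic): the cusp slope is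
non-positive on the whole closed chamber of `δ₀` iff it is non-positive at every ray of the rate arrangement lying in
that chamber (rates normalised to `[0, 1]`). -/
theorem cuspSlope_nonpos_on_chamber_iff_rays {a : Dir} (hpos : ∀ k, 0 < h28 a k) {T : ℝ} (hT : 0 < T)
    (hper : ∀ k : Fin 28, ∃ z : ℤ, T * h28 a k = z)
    {M : ℕ → Finset (Fin 28)} {f : ℕ → Finset (Fin 28) → ℝ}
    (hf : ∀ m, m + 1 < (bkpts a T).card → ∀ Δ : Fin 8 → ℝ, (∀ k, |phiForm Δ k| < 1) →
      (∀ k, |phiForm Δ k| < wallDist a T) →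
        (torusN (bkpt a T m • sParam a + Δ) : ℝ) = f m ((M m).filter fun k => 0 ≤ phiForm Δ k))
    {F : Finset (Fin 28) → ℝ} (hF : ∀ A, F A = ∑ m ∈ Finset.range ((bkpts a T).card - 1), f m (A ∩ M m))
    {δ₀ : Fin 8 → ℝ} (hgen : ∀ k l : Fin 28, k ≠ l → phiForm δ₀ k / h28 a k ≠ phiForm δ₀ l / h28 a l) :
    (∀ δ : Fin 8 → ℝ, (∀ k l : Fin 28, phiForm δ k / h28 a k < phiForm δ l / h28 a l →
        phiForm δ₀ k / h28 a k < phiForm δ₀ l / h28 a l) → cuspSlope a T δ ≤ 0) ↔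
      ∀ x : Fin 8 → ℝ, (∀ k l : Fin 28, phiForm x k / h28 a k < phiForm x l / h28 a l →
          phiForm δ₀ k / h28 a k < phiForm δ₀ l / h28 a l) →
        (∀ k, 0 ≤ phiForm x k / h28 a k ∧ phiForm x k / h28 a k ≤ 1) →
        ((∃ k l, phiForm x k / h28 a k ≠ phiForm x l / h28 a l) ∧
          ∀ d : Fin 8 → ℝ, (∀ k l, phiForm x k / h28 a k = phiForm x l / h28 a l →
            phiForm d k / h28 a k = phiForm d l / h28 a l) → ∃ u t : ℝ, d = u • x + t • sParam a) →
        cuspSlope a T x ≤ 0 := by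
  refine ⟨fun h x hx _ _ => h x hx, fun h δ href => ?_⟩
  by_contra hσ
  obtain ⟨x, hxref, hx01, hray, -, hval⟩ :=
    exists_ascent_ray_of_cuspSlope_pos hpos hT hper hf hF hgen href (not_le.mp hσ)
  exact (h x hxref hx01 hray).not_gt hval

/-! ### A cusp top, exactly — the V-side -/

/-- **A CUSP TOP, EXACTLY — THE RAY CRITERION** (any period pattern function `F`, any extension, NO type hypothesis,
NO generators supplied). All 28 forms of `a` positive, `T > 0` a period. `cuspSlope a T δ ≤ 0` for EVERY displacement
`δ` IF AND ONLY IF `cuspSlope a T x ≤ 0` at every RAY `x` of the rate arrangement — every displacement with rates in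
`[0, 1]`, two of them distinct, whose tie pattern is rigid (every tie-preserving displacement lies in `span{x, s(a)}`).
The test set depends on the direction `a` only (not on `T`, not on `F`); it is finite modulo `x ↦ u•x + t•s(a)`
(file (3)); no ray at a named direction is asserted or evaluated here. -/
theorem forall_cuspSlope_nonpos_iff_forall_ray {a : Dir} (hpos : ∀ k, 0 < h28 a k) {T : ℝ} (hT : 0 < T)
    (hper : ∀ k : Fin 28, ∃ z : ℤ, T * h28 a k = z)
    {M : ℕ → Finset (Fin 28)} {f : ℕ → Finset (Fin 28) → ℝ}
    (hf : ∀ m, m + 1 < (bkpts a T).card → ∀ Δ : Fin 8 → ℝ, (∀ k, |phiForm Δ k| < 1) →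
      (∀ k, |phiForm Δ k| < wallDist a T) →
        (torusN (bkpt a T m • sParam a + Δ) : ℝ) = f m ((M m).filter fun k => 0 ≤ phiForm Δ k))
    {F : Finset (Fin 28) → ℝ} (hF : ∀ A, F A = ∑ m ∈ Finset.range ((bkpts a T).card - 1), f m (A ∩ M m)) :
    (∀ δ, cuspSlope a T δ ≤ 0) ↔
      ∀ x : Fin 8 → ℝ, (∀ k, 0 ≤ phiForm x k / h28 a k ∧ phiForm x k / h28 a k ≤ 1) →
        ((∃ k l, phiForm x k / h28 a k ≠ phiForm x l / h28 a l) ∧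
          ∀ d : Fin 8 → ℝ, (∀ k l, phiForm x k / h28 a k = phiForm x l / h28 a l →
            phiForm d k / h28 a k = phiForm d l / h28 a l) → ∃ u t : ℝ, d = u • x + t • sParam a) →
        cuspSlope a T x ≤ 0 := by
  refine ⟨fun h x _ _ => h x, fun h δ => ?_⟩
  obtain ⟨δ₀, hgen, href⟩ := exists_generic_refines hpos δ
  exact (cuspSlope_nonpos_on_chamber_iff_rays hpos hT hper hf hF hgen).mpr (fun x _ hx01 hray => h x hx01 hray) δ href

/-- **AN ASCENT DIRECTION EXISTS IFF AN ASCENT RAY EXISTS** (any `F`, any extension): the contrapositive reading — at a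
direction which is not a cusp top some RAY of the rate arrangement ascends. -/
theorem exists_ascent_iff_exists_ascent_ray {a : Dir} (hpos : ∀ k, 0 < h28 a k) {T : ℝ} (hT : 0 < T)
    (hper : ∀ k : Fin 28, ∃ z : ℤ, T * h28 a k = z)
    {M : ℕ → Finset (Fin 28)} {f : ℕ → Finset (Fin 28) → ℝ}
    (hf : ∀ m, m + 1 < (bkpts a T).card → ∀ Δ : Fin 8 → ℝ, (∀ k, |phiForm Δ k| < 1) →
      (∀ k, |phiForm Δ k| < wallDist a T) →
        (torusN (bkpt a T m • sParam a + Δ) : ℝ) = f m ((M m).filter fun k => 0 ≤ phiForm Δ k))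
    {F : Finset (Fin 28) → ℝ} (hF : ∀ A, F A = ∑ m ∈ Finset.range ((bkpts a T).card - 1), f m (A ∩ M m)) :
    (∃ δ, 0 < cuspSlope a T δ) ↔
      ∃ x : Fin 8 → ℝ, (∀ k, 0 ≤ phiForm x k / h28 a k ∧ phiForm x k / h28 a k ≤ 1) ∧
        ((∃ k l, phiForm x k / h28 a k ≠ phiForm x l / h28 a l) ∧
          ∀ d : Fin 8 → ℝ, (∀ k l, phiForm x k / h28 a k = phiForm x l / h28 a l →
            phiForm d k / h28 a k = phiForm d l / h28 a l) → ∃ u t : ℝ, d = u • x + t • sParam a) ∧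
        0 < cuspSlope a T x := by
  constructor
  · rintro ⟨δ, hδ⟩
    obtain ⟨δ₀, hgen, href⟩ := exists_generic_refines hpos δ
    obtain ⟨x, -, hx01, hray, -, hval⟩ := exists_ascent_ray_of_cuspSlope_pos hpos hT hper hf hF hgen href hδ
    exact ⟨x, hx01, hray, hval⟩
  · rintro ⟨x, -, -, hx⟩
    exact ⟨x, hx⟩

/-! ### Per chamber: Farkas certificate ⇔ no ascent ⇔ rays non-positive -/

/-- **THE THREE CHAMBER TESTS ARE ONE** (any `F`, any extension; `δ₀` generic): the chamber of `δ₀` carries a FARKAS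
CERTIFICATE (P2 g34: `μ ≥ 0` with `G_{δ₀} + Σ_{ρ₀k<ρ₀l} μ_{kl}(r_l − r_k) ≡ 0`) IFF the cusp slope is non-positive at
every RAY of the rate arrangement lying in the closed chamber of `δ₀` — the H-description and the V-description of
«no ascent direction in this chamber» agree, with neither multipliers nor generators supplied as data. -/
theorem farkas_certificate_iff_rays_nonpos {a : Dir} (hpos : ∀ k, 0 < h28 a k) {T : ℝ} (hT : 0 < T)
    (hper : ∀ k : Fin 28, ∃ z : ℤ, T * h28 a k = z)
    {M : ℕ → Finset (Fin 28)} {f : ℕ → Finset (Fin 28) → ℝ}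
    (hf : ∀ m, m + 1 < (bkpts a T).card → ∀ Δ : Fin 8 → ℝ, (∀ k, |phiForm Δ k| < 1) →
      (∀ k, |phiForm Δ k| < wallDist a T) →
        (torusN (bkpt a T m • sParam a + Δ) : ℝ) = f m ((M m).filter fun k => 0 ≤ phiForm Δ k))
    {F : Finset (Fin 28) → ℝ} (hF : ∀ A, F A = ∑ m ∈ Finset.range ((bkpts a T).card - 1), f m (A ∩ M m))
    {δ₀ : Fin 8 → ℝ} (hgen : ∀ k l : Fin 28, k ≠ l → phiForm δ₀ k / h28 a k ≠ phiForm δ₀ l / h28 a l) :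
    (∃ μ : Fin 28 → Fin 28 → ℝ, (∀ k l, 0 ≤ μ k l) ∧ ∀ δ : Fin 8 → ℝ,
        ∑ k, (F (Finset.univ.filter fun l => phiForm δ₀ k / h28 a k ≤ phiForm δ₀ l / h28 a l) -
            F (Finset.univ.filter fun l => phiForm δ₀ k / h28 a k < phiForm δ₀ l / h28 a l)) *
          (phiForm δ k / h28 a k) +
        ∑ k, ∑ l, (if phiForm δ₀ k / h28 a k < phiForm δ₀ l / h28 a l then
          μ k l * (phiForm δ l / h28 a l - phiForm δ k / h28 a k) else 0) = 0) ↔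
      ∀ x : Fin 8 → ℝ, (∀ k l : Fin 28, phiForm x k / h28 a k < phiForm x l / h28 a l →
          phiForm δ₀ k / h28 a k < phiForm δ₀ l / h28 a l) →
        (∀ k, 0 ≤ phiForm x k / h28 a k ∧ phiForm x k / h28 a k ≤ 1) →
        ((∃ k l, phiForm x k / h28 a k ≠ phiForm x l / h28 a l) ∧
          ∀ d : Fin 8 → ℝ, (∀ k l, phiForm x k / h28 a k = phiForm x l / h28 a l →
            phiForm d k / h28 a k = phiForm d l / h28 a l) → ∃ u t : ℝ, d = u • x + t • sParam a) →
        cuspSlope a T x ≤ 0 := by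
  rw [← cuspSlope_nonpos_on_chamber_iff_rays hpos hT hper hf hF hgen]
  constructor
  · rintro ⟨μ, hμ, hid⟩ δ href
    exact cuspSlope_nonpos_of_refines_of_farkas_certificate hpos hT hper hf hF hgen hμ hid δ href
  · intro h
    exact exists_farkas_certificate_of_cuspSlope_nonpos_on_chamber hpos hT hper hf hF hgen h

/-! ### Canonical forms: the saving's own period pattern function -/

/-- **AN ASCENT DIRECTION IN A CHAMBER FORCES AN ASCENT RAY — CANONICAL FORM, NO STRUCTURAL HYPOTHESIS.** All 28 forms of
`a` positive, `T > 0` a period, `F = Σ_m patternN a b_m` (P2 g33), `δ₀` generic: an ascent direction in the closed chamber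
of `δ₀` forces an ascent ray of that chamber, normalised to rates in `[0, 1]` and maximising `σ` over the chamber cut to
rate spread `≤ 1`. -/
theorem exists_ascent_ray_of_cuspSlope_pos_canonical {a : Dir} (hpos : ∀ k, 0 < h28 a k) {T : ℝ} (hT : 0 < T)
    (hper : ∀ k : Fin 28, ∃ z : ℤ, T * h28 a k = z) {F : Finset (Fin 28) → ℝ}
    (hF : ∀ A, F A = ∑ m ∈ Finset.range ((bkpts a T).card - 1), ((patternN a (bkpt a T m) A : ℤ) : ℝ))
    {δ₀ : Fin 8 → ℝ} (hgen : ∀ k l : Fin 28, k ≠ l → phiForm δ₀ k / h28 a k ≠ phiForm δ₀ l / h28 a l)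
    {δ : Fin 8 → ℝ} (href : ∀ k l : Fin 28, phiForm δ k / h28 a k < phiForm δ l / h28 a l →
      phiForm δ₀ k / h28 a k < phiForm δ₀ l / h28 a l) (hσ : 0 < cuspSlope a T δ) :
    ∃ x : Fin 8 → ℝ, (∀ k l : Fin 28, phiForm x k / h28 a k < phiForm x l / h28 a l →
        phiForm δ₀ k / h28 a k < phiForm δ₀ l / h28 a l) ∧
      (∀ k, 0 ≤ phiForm x k / h28 a k ∧ phiForm x k / h28 a k ≤ 1) ∧
      ((∃ k l, phiForm x k / h28 a k ≠ phiForm x l / h28 a l) ∧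
        ∀ d : Fin 8 → ℝ, (∀ k l, phiForm x k / h28 a k = phiForm x l / h28 a l →
          phiForm d k / h28 a k = phiForm d l / h28 a l) → ∃ u t : ℝ, d = u • x + t • sParam a) ∧
      (∀ δ' : Fin 8 → ℝ, (∀ k l : Fin 28, phiForm δ' k / h28 a k < phiForm δ' l / h28 a l →
          phiForm δ₀ k / h28 a k < phiForm δ₀ l / h28 a l) →
        (∀ k l, phiForm δ' k / h28 a k - phiForm δ' l / h28 a l ≤ 1) → cuspSlope a T δ' ≤ cuspSlope a T x) ∧
      0 < cuspSlope a T x := by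
  classical
  exact exists_ascent_ray_of_cuspSlope_pos hpos hT hper
    (M := fun m => Finset.univ.filter fun k => ∃ z : ℤ, bkpt a T m * h28 a k = z)
    (f := fun m A => ((patternN a (bkpt a T m) A : ℤ) : ℝ)) (canonical_junction_agreement a T)
    (canonical_period_eq_sum_inter hF) hgen href hσ

/-- **A CUSP TOP, EXACTLY — THE RAY CRITERION, CANONICAL FORM, NO STRUCTURAL HYPOTHESIS.** All 28 forms of `a`
positive, `T > 0` a period, `F = Σ_m patternN a b_m`: `cuspSlope a T δ ≤ 0` for every `δ` IFF `cuspSlope a T x ≤ 0` at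
every ray `x` of the rate arrangement (rates in `[0,1]`, two distinct, rigid tie pattern) — inputs: the direction, the
period, the saving's own formula; the test set depends on the direction alone; no instance asserted. -/
theorem forall_cuspSlope_nonpos_iff_forall_ray_canonical {a : Dir} (hpos : ∀ k, 0 < h28 a k) {T : ℝ} (hT : 0 < T)
    (hper : ∀ k : Fin 28, ∃ z : ℤ, T * h28 a k = z) {F : Finset (Fin 28) → ℝ}
    (hF : ∀ A, F A = ∑ m ∈ Finset.range ((bkpts a T).card - 1), ((patternN a (bkpt a T m) A : ℤ) : ℝ)) :
    (∀ δ, cuspSlope a T δ ≤ 0) ↔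
      ∀ x : Fin 8 → ℝ, (∀ k, 0 ≤ phiForm x k / h28 a k ∧ phiForm x k / h28 a k ≤ 1) →
        ((∃ k l, phiForm x k / h28 a k ≠ phiForm x l / h28 a l) ∧
          ∀ d : Fin 8 → ℝ, (∀ k l, phiForm x k / h28 a k = phiForm x l / h28 a l →
            phiForm d k / h28 a k = phiForm d l / h28 a l) → ∃ u t : ℝ, d = u • x + t • sParam a) →
        cuspSlope a T x ≤ 0 := by
  classical
  exact forall_cuspSlope_nonpos_iff_forall_ray hpos hT hper
    (M := fun m => Finset.univ.filter fun k => ∃ z : ℤ, bkpt a T m * h28 a k = z)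
    (f := fun m A => ((patternN a (bkpt a T m) A : ℤ) : ℝ)) (canonical_junction_agreement a T)
    (canonical_period_eq_sum_inter hF)

/-- **THE THREE CHAMBER TESTS ARE ONE — CANONICAL FORM** (`F = Σ_m patternN a b_m`; `δ₀` generic): the chamber Farkas
certificate exists iff the cusp slope is non-positive at every ray of the rate arrangement in the closed chamber. -/
theorem farkas_certificate_iff_rays_nonpos_canonical {a : Dir} (hpos : ∀ k, 0 < h28 a k) {T : ℝ} (hT : 0 < T)
    (hper : ∀ k : Fin 28, ∃ z : ℤ, T * h28 a k = z) {F : Finset (Fin 28) → ℝ}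
    (hF : ∀ A, F A = ∑ m ∈ Finset.range ((bkpts a T).card - 1), ((patternN a (bkpt a T m) A : ℤ) : ℝ))
    {δ₀ : Fin 8 → ℝ} (hgen : ∀ k l : Fin 28, k ≠ l → phiForm δ₀ k / h28 a k ≠ phiForm δ₀ l / h28 a l) :
    (∃ μ : Fin 28 → Fin 28 → ℝ, (∀ k l, 0 ≤ μ k l) ∧ ∀ δ : Fin 8 → ℝ,
        ∑ k, (F (Finset.univ.filter fun l => phiForm δ₀ k / h28 a k ≤ phiForm δ₀ l / h28 a l) -
            F (Finset.univ.filter fun l => phiForm δ₀ k / h28 a k < phiForm δ₀ l / h28 a l)) *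
          (phiForm δ k / h28 a k) +
        ∑ k, ∑ l, (if phiForm δ₀ k / h28 a k < phiForm δ₀ l / h28 a l then
          μ k l * (phiForm δ l / h28 a l - phiForm δ k / h28 a k) else 0) = 0) ↔
      ∀ x : Fin 8 → ℝ, (∀ k l : Fin 28, phiForm x k / h28 a k < phiForm x l / h28 a l →
          phiForm δ₀ k / h28 a k < phiForm δ₀ l / h28 a l) →
        (∀ k, 0 ≤ phiForm x k / h28 a k ∧ phiForm x k / h28 a k ≤ 1) →
        ((∃ k l, phiForm x k / h28 a k ≠ phiForm x l / h28 a l) ∧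
          ∀ d : Fin 8 → ℝ, (∀ k l, phiForm x k / h28 a k = phiForm x l / h28 a l →
            phiForm d k / h28 a k = phiForm d l / h28 a l) → ∃ u t : ℝ, d = u • x + t • sParam a) →
        cuspSlope a T x ≤ 0 := by
  classical
  exact farkas_certificate_iff_rays_nonpos hpos hT hper
    (M := fun m => Finset.univ.filter fun k => ∃ z : ℤ, bkpt a T m * h28 a k = z)
    (f := fun m A => ((patternN a (bkpt a T m) A : ℤ) : ℝ)) (canonical_junction_agreement a T)
    (canonical_period_eq_sum_inter hF) hgen

end Summit.KontsevichZagierPeriods.Zeta5Search.Barrier.ConeGamma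

end
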